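import Summits.BirchSwinnertonDyer.BirchSwinnertonDyer.Theorems.RamifiedHeegnerPairLeafPartnerRoadR1Zero
import Summits.BirchSwinnertonDyer.BirchSwinnertonDyer.Theorems.RamifiedHeegnerPairLeafPartnerPairingCoreZeroFlat
import HarnessLib

/-!
# Route `RamifiedHeegnerPair`, crux U₀ `LeafRankZeroUpperAtThree` (stmt-BirchSwinnertonDyer-26024), line `splitkolyvagin0` (partner cut, mirror of U₁'s
# `partnerdescent` v5) — partner kernel part U0-♭2: ROAD₀-R1♭ — the rank-ZERO partner road on ORPHAN PAIRS with a non-scalar prime, from (G3♭)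

HONEST FRAMING. Theorems only; helper file (`--supports stmt-BirchSwinnertonDyer-26024 --as helper`); no definition, no named fact, no
`sorry`; nothing booked, no item closed; CONDITIONAL on every displayed input — in particular on the derivation-grade stub (G3♭) and the
print-composite PARTNER GENUS DISPLAY (one rank-free text serving U₁ and U₀) — BSD is proved for no curve. Lead prover bsd-line-rhp-p2 g58,
2026-08-30. Rank-zero mirror of `…Theorems.RamifiedHeegnerPairLeafPartnerRoadR1Flat.lean` (partner kernel part 13, p783371, lead g57).

WHAT. `leafPartnerRoadR1PairZeroFlat_of_G3flat_of_display_of_supply` = the tree's `leafPartnerRoadR1PairingZero_of_G3_of_display_of_supply`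
(p776949, lead g55) with the habitat cut to an orphan PAIR `{q, r}` (two odd split-multiplicative primes with `(−3/·) = 1`, très-ramifié
clause off the pair) on which `W` does NOT have full `3`-torsion over `ℚ_q` (`#W(ℚ_q)[3] ≠ 9` — transported to the partner `V` through
`V ⊗ ℚ_q ≅ W ⊗ ℚ_q`, `−3` being a square in `ℚ_q`: `natCard_torsionBy_three_partner_ne_nine`), and the hypothesis (G3) REPLACED by the FLAT
(G3♭), over part U0-♭1 (`…LeafPartnerPairingCoreZeroFlat`). The field is Friedberg–Hoffstein's with sign `+1`, the pair inert (so `S ≠ ∅`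
automatically) and the twist with a simple zero; the partner lower half is L₁ `Gss2LowerAtThreeRankOne`. WHY: as U₁ v5 — (G3♭) is implied by
the route item 27595 AND is the shape of the lead's pen-agreed derivation from print; the doubly-scalar orphan pairs (census: 3 classes below
`N_V = 5·10⁵`, none ≤ 55 555, LEAD-G57-G3-LEDGER.md) and `|S| ≥ 4` go back to U₀'s residue stub. CONDITIONAL; nothing booked.
-- adapted from Summits/BirchSwinnertonDyer/BirchSwinnertonDyer/Theorems/RamifiedHeegnerPairLeafPartnerRoadR1Zero.lean ((G3) ↦ (G3♭), S ↦ a pair with a non-scalar prime)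

References: [cite: CaiShuTian2014, Thm. 1.5] [cite: PapikianRabinoff2016, Thm. 30, Lemma 32] [cite: AbbesUllmo1996, Thm. A]
[cite: FriedbergHoffstein1995, Thm. B] [cite: GrossZagier1986, V.§2] [cite: SilvermanAEC2009, X.5 Cor. 5.4] [cite: Matsuno2009, proof of Cor. 6.2].
presearch: as the rank-one sibling (corpus+galaxy; no assembled partner road in print).
-/

-- D-0017: single-problem summit, so `Summit.BirchSwinnertonDyer.BirchSwinnertonDyer.…` repeats a namespace BY DESIGN.
set_option linter.dupNamespace false
set_option autoImplicit false

noncomputable section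

open scoped Classical NumberField

open WeierstrassCurve NumberField IsDedekindDomain Literature Literature.NumberTheory.EllipticCurves
  Rat.HeightOneSpectrum CongruenceSubgroup
  Literature.NumberTheory.EllipticCurves.ModularForms
  Literature.NumberTheory.EllipticCurves.Rank1Residual
  Literature.NumberTheory.EllipticCurves.Rank1Residual.Typed
  Literature.NumberTheory.QuadraticFields.Quadratic
  Literature.NumberTheory.GaloisCohomology
  Literature.NumberTheory.Automorphic
  Summit.BirchSwinnertonDyer.Rank1Residual
  Summit.BirchSwinnertonDyer.Rank1Residual.Additive
  Summit.BirchSwinnertonDyer.Rank1Residual.X11b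
  Summit.BirchSwinnertonDyer.Rank1Residual.X11b.Three
  Summit.BirchSwinnertonDyer.BirchSwinnertonDyer.Theses.RamifiedHeegnerPair
  Summit.BirchSwinnertonDyer.BirchSwinnertonDyer.Theorems
  Summit.BirchSwinnertonDyer.BirchSwinnertonDyer.Theorems.RamifiedPairUpperBound

namespace Summit.BirchSwinnertonDyer.BirchSwinnertonDyer.Theorems.LeafShimuraInert

/-- **`#V(ℚ_q)[3] = #W(ℚ_q)[3]` for the partner `V = CV • W^{(−3)}` at an odd prime `q` with `(−3/q) = 1`**: `−3` is a square in
`ℚ_q`, so `V ⊗ ℚ_q ≅ W ⊗ ℚ_q` by a variable change, and an isomorphism of groups `W(ℚ_q) ≃+ V(ℚ_q)` preserves the `3`-torsion count; in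
particular `#W(ℚ_q)[3] ≠ 9 → #V(ℚ_q)[3] ≠ 9`. (The block of the U₁ road p783371, as a lemma.)
-- adapted from Summits/BirchSwinnertonDyer/BirchSwinnertonDyer/Theorems/RamifiedHeegnerPairLeafPartnerRoadR1Flat.lean (inline block ↦ lemma)
[cite: SilvermanAEC2009, X.5 Cor. 5.4] -/
theorem natCard_torsionBy_three_partner_eq (W : WeierstrassCurve ℚ) [W.IsElliptic] (CV : VariableChange ℚ)
    (V : WeierstrassCurve ℚ) (hV : CV • W.quadraticTwist (-3 : ℚ) = V)
    (q : ℕ) [Fact q.Prime] (hq2 : q ≠ 2) (hJq : jacobiSym (-3) q = 1) :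
    Nat.card (AddSubgroup.torsionBy ((V.baseChange ℚ_[q]).toAffine.Point) 3) =
      Nat.card (AddSubgroup.torsionBy ((W.baseChange ℚ_[q]).toAffine.Point) 3) := by
  have hd : (-3 : ℚ) ≠ 0 := by norm_num
  have hsqZ : IsSquare (((-3 : ℤ) : ℤ) : ℚ_[q]) := padic_isSquare_of_jacobiSym_eq_one hq2 hJq
  have hsq : IsSquare (algebraMap ℚ ℚ_[q] (-3 : ℚ)) := by
    have : algebraMap ℚ ℚ_[q] (-3 : ℚ) = (((-3 : ℤ) : ℤ) : ℚ_[q]) := by push_cast; simp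
    rw [this]; exact hsqZ
  haveI : (W.baseChange ℚ_[q]).IsElliptic := inferInstanceAs (W.map (algebraMap ℚ ℚ_[q])).IsElliptic
  obtain ⟨θ, hθ⟩ := hsq
  have hθ0 : θ ≠ 0 := by
    rintro rfl
    exact (map_ne_zero (algebraMap ℚ ℚ_[q])).mpr hd (hθ.trans (mul_zero 0))
  obtain ⟨C, hC⟩ := (W.baseChange ℚ_[q]).exists_variableChange_smul_eq_quadraticTwist_sq hθ0
  have h1 : (W.quadraticTwist (-3 : ℚ)).baseChange ℚ_[q] = C • W.baseChange ℚ_[q] := by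
    rw [hC, baseChange, baseChange, map_quadraticTwist, hθ, sq]
  have hYX : V.baseChange ℚ_[q] = (CV.map (algebraMap ℚ ℚ_[q]) * C) • W.baseChange ℚ_[q] := by
    rw [← hV, WeierstrassCurve.VariableChange.baseChange_smul_eq (W.quadraticTwist (-3 : ℚ)) CV ℚ_[q], h1, mul_smul]
  -- an isomorphism of groups `W(ℚ_q) ≃+ V(ℚ_q)` preserves the `3`-torsion count
  let e : (W.baseChange ℚ_[q]).toAffine.Point ≃+ (V.baseChange ℚ_[q]).toAffine.Point :=
    (VariableChange.pointEquiv (W.baseChange ℚ_[q]) (CV.map (algebraMap ℚ ℚ_[q]) * C)).trans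
      (Affine.Point.congrEquiv hYX.symm)
  refine (Nat.card_congr (e.toEquiv.subtypeEquiv fun a => ?_)).symm
  show a ∈ AddSubgroup.torsionBy _ 3 ↔ e a ∈ AddSubgroup.torsionBy _ 3
  simp only [AddSubgroup.torsionBy, Submodule.mem_toAddSubgroup, Submodule.mem_torsionBy_iff]
  rw [← map_zsmul e, EmbeddingLike.map_eq_zero_iff]

/-- **ROAD₀-R1♭ AT RANK ZERO (orphan PAIRS with a non-scalar prime) ⟸ (G3♭) ∧ PARTNER GENUS DISPLAY ∧ FH₁ ∧ {GZK, entireness, newform,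
Abbes–Ullmo} ∧ JL ∧ L₁.** VERBATIM the tree's `leafPartnerRoadR1PairingZero_of_G3_of_display_of_supply` (p776949) with the habitat cut to an
orphan PAIR `{q, r}` (two odd split-multiplicative primes with `(−3/·) = 1`, très-ramifié clause off the pair) on which `W` does NOT have
full `3`-torsion over `ℚ_q` (`#W(ℚ_q)[3] ≠ 9`), and the hypothesis (G3) REPLACED by the FLAT (G3♭) (part U0-♭1). For a non-CM leaf curve
`W` (`Addv W 3`, `SubGss W 3`, `r_an = 0`) with an `X₀(N)`-datum `Dt`, `3 ∤ c(Dt)`, on such a row: `Typed.MissingUpperBoundAt W 3`.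
CONDITIONAL; nothing booked; BSD is not proved.
-- adapted from Summits/BirchSwinnertonDyer/BirchSwinnertonDyer/Theorems/RamifiedHeegnerPairLeafPartnerRoadR1Zero.lean ((G3) ↦ (G3♭), S ↦ a pair with a non-scalar prime)
[cite: CaiShuTian2014, Thm. 1.5] [cite: PapikianRabinoff2016, Thm. 30, Lemma 32] [cite: FriedbergHoffstein1995, Thm. B] [cite: GrossZagier1986, V.§2] -/
theorem leafPartnerRoadR1PairZeroFlat_of_G3flat_of_display_of_supply
    (hG3 : ∃ cI cJ : ComponentOrderFun,
      (∀ {D M : ℕ} {X : ShimuraCurveData D M} {W' : WeierstrassCurve ℚ}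
          (P : ShimuraParametrizationData X W') (p : ℕ), 0 < cI P p ∧ 0 < cJ P p) ∧
      ComponentOrders.ProductEq cI cJ ∧ ComponentOrders.Prop613 cI cJ ∧
      ComponentOrders.ImageEisenstein cI ∧ ComponentOrders.CokernelDvd cJ ∧
      (∀ {N D M : ℕ}, IsAdmissibleFactorization N D M →
        ∀ (X : ShimuraCurveData D M) (V : WeierstrassCurve ℚ) [V.IsElliptic] [V.IsGloballyMinimal],
          V.conductorNorm ℤ = N → ¬ 3 ∣ N → Irr V 3 →
        ∀ (q r : ℕ) [Fact q.Prime] [Fact r.Prime], q ≠ r → D = q * r →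
          Nat.card (AddSubgroup.torsionBy ((V.baseChange ℚ_[q]).toAffine.Point) 3) ≠ 9 →
        ∀ (V' : WeierstrassCurve ℚ) [V'.IsElliptic] (P : ShimuraParametrizationData X V'),
          P.IsMinimalFor V → ¬ 3 ∣ cJ P r))
    (hDisp : ∀ (W : WeierstrassCurve ℚ) [W.IsElliptic] [W.IsGloballyMinimal] (N : ℕ) [NeZero N]
      (Dt : ModularParametrizationData W N),
      ¬ W.HasCM → Addv W 3 → SubGss W 3 → W.conductorNorm ℤ = N →
      ∀ (V : WeierstrassCurve ℚ) [V.IsElliptic] [V.IsGloballyMinimal] (CV : VariableChange ℚ),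
        CV • W.quadraticTwist (-3) = V →
      ∀ (NV : ℕ) [NeZero NV] (V₀ : WeierstrassCurve ℚ) [V₀.IsElliptic] [V₀.IsGloballyMinimal]
        (D₀ : ModularParametrizationData V₀ NV),
        V.conductorNorm ℤ = NV → IsNewformOf V D₀.f →
        (∀ (V₂ : WeierstrassCurve ℚ) [V₂.IsElliptic] (D₂ : ModularParametrizationData V₂ NV),
          D₂.f = D₀.f → D₀.modularDegree ≤ D₂.modularDegree) →
      ∀ (K : Type) [Field K] [NumberField K] (S : Finset ℕ)
        (X : ShimuraCurveData (∏ q ∈ S, q) (NV / ∏ q ∈ S, q))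
        (V' : WeierstrassCurve ℚ) [V'.IsElliptic] (P₀ : ShimuraParametrizationData X V'),
        IsImaginaryQuadratic K → Odd (NumberField.discr K) → Even S.card →
        (∀ ℓ ∈ S, ∃ _ : Fact ℓ.Prime, W.HasMultiplicativeReductionAtPrime ℓ ∧
          ((Ideal.span {(ℓ : ℤ)}).primesOver (𝓞 K)).ncard = 1 ∧ ¬ (ℓ : ℤ) ∣ NumberField.discr K) →
        (∀ ℓ : ℕ, ℓ.Prime → ℓ ∣ N → ℓ ∉ S → ((Ideal.span {(ℓ : ℤ)}).primesOver (𝓞 K)).ncard = 2) →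
        P₀.IsMinimalFor V →
        ∃ (P : (W.baseChange K).toAffine.Point) (degS : ℕ), 0 < degS ∧
          padicValNat 3 degS = padicValNat 3 P₀.deg ∧
          (degS : ℂ) * LDerivEK W K =
            ((2 * ZLattice.covolume Dt.L.lattice * (D₀.modularDegree : ℝ) /
                ((D₀.c : ℝ) ^ 2 * ((Units.torsionOrder K : ℝ) / 2) ^ 2 * √|(NumberField.discr K : ℝ)|) *
              P.canonicalHeight : ℝ) : ℂ) ∧
          (¬ IsOfFinAddOrder P →
            Nat.card (AddCommGroup.primaryComponent (W.baseChange K).sha 3) ≤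
              3 ^ (2 * padicValNat 3 (AddSubgroup.zmultiples P).index)))
    (hFH1 : friedbergHoffstein_exists_twist_simpleZero_inertAt_splitAt)
    (hGZK : rank_eq_analyticRank_of_analyticRank_le_one) (hmod : hasEntireLFunction_rat)
    (hnf : exists_isNewformOf) (hAU : abbesUllmo_not_dvd_maninConstant_of_not_dvd_level)
    (hJL : nonempty_shimuraParametrizationData)
    (hL1 : Gss2LowerAtThreeRankOne) :
    ∀ (W : WeierstrassCurve ℚ) [W.IsElliptic] [W.IsGloballyMinimal] (N : ℕ) [NeZero N]
      (Dt : ModularParametrizationData W N),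
      ¬ W.HasCM → Addv W 3 → SubGss W 3 → W.analyticRank = 0 → W.conductorNorm ℤ = N →
      (∀ z ∈ Dt.L.lattice, ∃ w ∈ periodLattice Dt.f, z = Dt.c * w) → ¬ (3 : ℤ) ∣ Dt.c →
      (∀ (q : ℕ) [Fact q.Prime], 3 ∣ (W.baseChange ℚ_[q]).localTamagawaNumber ℤ_[q] →
        W.HasSplitMultiplicativeReductionAtPrime q) →
      (∃ (q r : ℕ) (_ : Fact q.Prime) (_ : Fact r.Prime), q ≠ r ∧
        Nat.card (AddSubgroup.torsionBy ((W.baseChange ℚ_[q]).toAffine.Point) 3) ≠ 9 ∧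
        (∀ ℓ ∈ ({q, r} : Finset ℕ), ∃ _ : Fact ℓ.Prime, W.HasSplitMultiplicativeReductionAtPrime ℓ ∧ ℓ ≠ 2 ∧ jacobiSym (-3) ℓ = 1) ∧
        (∀ (ℓ : ℕ) [Fact ℓ.Prime], ℓ ∉ ({q, r} : Finset ℕ) → W.HasSplitMultiplicativeReductionAtPrime ℓ →
          ¬ 3 ∣ padicValInt ℓ W.minimalDiscriminantInt)) →
      MissingUpperBoundAt W 3 := by
  intro W _ _ N _ Dt hCM hadd hsub hr hN _ hc hshape hrow
  obtain ⟨q, r, hqF, hrF, hqr, hnsW, hS, hFC⟩ := hrow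
  set S : Finset ℕ := ({q, r} : Finset ℕ) with hS_def
  have hqr' : q ∉ ({r} : Finset ℕ) := by simp [hqr]
  have hSeven : Even S.card := by
    rw [hS_def, Finset.card_insert_of_notMem hqr', Finset.card_singleton]; exact ⟨1, rfl⟩
  have hSne : S.Nonempty := ⟨q, by simp [hS_def]⟩
  subst hN
  haveI h3F : Fact (Nat.Prime 3) := ⟨Nat.prime_three⟩
  have hp : (3 : ℕ).Prime := Nat.prime_three
  have hirr : W.HasIrreducibleModPGaloisRep 3 := Additive.irr_of_subGss_of_ne_two W 3 (by decide) hadd hsub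
  have hSmult : ∀ ℓ ∈ S, ∃ _ : Fact ℓ.Prime, W.HasMultiplicativeReductionAtPrime ℓ := fun ℓ hℓ ↦ by
    obtain ⟨hℓF, hs, -, -⟩ := hS ℓ hℓ
    exact ⟨hℓF, hs.toHasMultiplicativeReduction⟩
  ---------------------------------------------------------------- the `3`-good partner `V`
  have hd : (-3 : ℚ) ≠ 0 := by norm_num
  haveI hEt : (W.quadraticTwist (-3 : ℚ)).IsElliptic := W.isElliptic_quadraticTwist hd
  obtain ⟨CV, hCVmin⟩ := hasGlobalMinimalModel_rat_holds (W.quadraticTwist (-3 : ℚ))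
  haveI : (CV • W.quadraticTwist (-3 : ℚ)).IsGloballyMinimal := hCVmin
  set V : WeierstrassCurve ℚ := CV • W.quadraticTwist (-3 : ℚ) with hV_def
  have hV : CV • W.quadraticTwist (-3 : ℚ) = V := rfl
  have hgoodV : V.HasGoodReductionAtPrime 3 := hasGoodReductionAtPrime_three_of_smul_eq_quadraticTwist_negThree W hadd hsub CV hV
  have hNV0 : V.conductorNorm ℤ ≠ 0 := (V.conductorNorm_pos_holds).ne'
  haveI : NeZero (V.conductorNorm ℤ) := ⟨hNV0⟩
  have h3NV : ¬ 3 ∣ V.conductorNorm ℤ := fun h ↦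
    ((V.dvd_conductorNorm_iff_not_hasGoodReductionAtPrime 3).mp h) hgoodV
  have hirrV : V.HasIrreducibleModPGaloisRep 3 := by
    rw [← hV, Mazur1978.hasIrreducibleModPGaloisRep_smul_iff]
    refine hasIrreducibleModPGaloisRep_quadraticTwist W ?_ 3 hirr
    rintro ⟨r, hr⟩
    nlinarith [mul_self_nonneg r]
  have hSV : ∀ ℓ ∈ S, ∃ _ : Fact ℓ.Prime, V.HasSplitMultiplicativeReductionAtPrime ℓ ∧
      padicValInt ℓ V.minimalDiscriminantInt = padicValInt ℓ W.minimalDiscriminantInt := fun ℓ hℓ ↦ by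
    obtain ⟨hℓF, hs, hℓ2, hJ⟩ := hS ℓ hℓ
    exact ⟨hℓF, split_and_ordDiscr_eq_of_smul_eq_quadraticTwist_negThree W CV hV ℓ hℓ2 hJ hs⟩
  have hSmultV : ∀ ℓ ∈ S, ∃ _ : Fact ℓ.Prime, V.HasMultiplicativeReductionAtPrime ℓ := fun ℓ hℓ ↦ by
    obtain ⟨hℓF, hs, -⟩ := hSV ℓ hℓ
    exact ⟨hℓF, hs.toHasMultiplicativeReduction⟩
  have hΔS : ∀ ℓ ∈ S, padicValInt ℓ V.minimalDiscriminantInt = padicValInt ℓ W.minimalDiscriminantInt := fun ℓ hℓ ↦ by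
    obtain ⟨_, -, h⟩ := hSV ℓ hℓ
    exact h
  ---------------------------------------------------------------- `#V(ℚ_q)[3] = #W(ℚ_q)[3]` (`−3` is a square in `ℚ_q`)
  have hnsV : Nat.card (AddSubgroup.torsionBy ((V.baseChange ℚ_[q]).toAffine.Point) 3) ≠ 9 := by
    obtain ⟨_, -, hq2, hJq⟩ := hS q (by simp [hS_def])
    rw [natCard_torsionBy_three_partner_eq W CV V hV q hq2 hJq]; exact hnsW
  ---------------------------------------------------------------- the optimal datum of the partner's class, `3 ∤ c`
  obtain ⟨V₀, hV₀, hV₀m, D₀, hfV, -, hminV⟩ :=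
    exists_optimal_modularParametrizationData_of_modularity hnf (V.conductorNorm ℤ) V rfl
  haveI := hV₀
  haveI := hV₀m
  have hoptV : ∀ z ∈ D₀.L.lattice, ∃ w ∈ periodLattice D₀.f, z = D₀.c * w :=
    D₀.latticeEq_of_forall_modularDegree_le hminV
  have hcV : ¬ (3 : ℤ) ∣ D₀.c := hAU V₀ D₀ hoptV 3 hp h3NV
  ---------------------------------------------------------------- the Friedberg–Hoffstein field: sign `+1`, `S ≠ ∅` inert, the twist with a simple zero
  have hw : W.rootNumber = 1 := by
    rw [WeierstrassCurve.rootNumber_eq_neg_one_pow_analyticRank_of_exists_isNewformOf hnf W, hr]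
    norm_num
  obtain ⟨p₀, hp₀F, hgood₀⟩ := exists_goodPrime W
  obtain ⟨K, _, _, hK, -, hinert, hsplitN, hsplit2, -, hLt0, hLt1⟩ := hFH1 W hw S hSmult hSeven hSne p₀ hgood₀ 4
  have hodd : Odd (NumberField.discr K) := by
    by_cases h2S : 2 ∈ S
    · obtain ⟨hn, hd2⟩ := hinert 2 h2S
      exact odd_discr_of_two_inert_or_split hK.1
        (Or.inl ⟨by simpa only [Nat.cast_ofNat] using hn, by simpa only [Nat.cast_ofNat] using hd2⟩)
    · by_cases h2N : 2 ∣ W.conductorNorm ℤ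
      · have hn := hsplitN 2 Nat.prime_two h2N h2S
        exact odd_discr_of_two_inert_or_split hK.1 (Or.inr (by simpa only [Nat.cast_ofNat] using hn))
      · exact odd_discr_of_two_inert_or_split hK.1 (Or.inr (hsplit2 h2N))
  -- `3` splits (it is a bad prime outside `S`)
  have hbad3 : ¬ W.HasGoodReductionAtPrime 3 := not_good_of_addv W 3 hadd
  have h3S : 3 ∉ S := by
    intro h
    obtain ⟨_, hm⟩ := hSmult 3 h
    exact not_mult_of_addv W 3 hadd hm
  have h3N : 3 ∣ W.conductorNorm ℤ := (W.dvd_conductorNorm_iff_not_hasGoodReductionAtPrime 3).mpr hbad3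
  have hps2 : ((Ideal.span {((3 : ℕ) : ℤ)}).primesOver (𝓞 K)).ncard = 2 := hsplitN 3 hp h3N h3S
  have hH3 : SatisfiesHeegnerHypothesis 3 K := fun q hq hq3 ↦ by
    have : q = 3 := (Nat.prime_dvd_prime_iff_eq hq hp).mp hq3
    subst this; exact hps2
  have hSin : ∀ ℓ ∈ S, ∃ _ : Fact ℓ.Prime, W.HasMultiplicativeReductionAtPrime ℓ ∧
      ((Ideal.span {(ℓ : ℤ)}).primesOver (𝓞 K)).ncard = 1 ∧ ¬ (ℓ : ℤ) ∣ NumberField.discr K := fun ℓ hℓ ↦ by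
    obtain ⟨hℓF, hm⟩ := hSmult ℓ hℓ
    exact ⟨hℓF, hm, hinert ℓ hℓ⟩
  ---------------------------------------------------------------- the rank-zero partner pairing core
  exact leafRankZeroUpper_three_of_partnerDatum_at_pair_flat hGZK hmod hJL hG3 W hadd hsub hr rfl Dt hc V rfl h3NV hirrV V₀ D₀ hfV
    hminV hcV q r hqr hnsV S hS_def hSeven hSmult hSmultV hΔS (fun ℓ _ hℓS hs ↦ hFC ℓ hℓS hs) hshape K hK hodd hinert hsplitN hLt0 hLt1
    (fun X V' _ P₀ hP₀ ↦ hDisp W (W.conductorNorm ℤ) Dt hCM hadd hsub rfl V CV hV (V.conductorNorm ℤ) V₀ D₀ rfl hfV hminV K S X V' P₀ hK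
      hodd hSeven hSin hsplitN hP₀)
    (fun Wd _ _ Cd hWd ↦ partnerLowerSplitThreeRankOne_of_lowerRankOne hmod hL1 W hCM hadd hsub K hK hodd hH3 hLt0 hLt1 Wd Cd hWd)

end Summit.BirchSwinnertonDyer.BirchSwinnertonDyer.Theorems.LeafShimuraInert

end
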